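import Mathlib
import HarnessLib
import Literature.Computability.AlgebraicComplexity.AsymptoticSpectrum
import Literature.Computability.AlgebraicComplexity.BorderRankCW
import Literature.Computability.AlgebraicComplexity.BILPS19MinrankVarieties
import Literature.Computability.AlgebraicComplexity.BILPS19MinrankInvarianceProofs
import Literature.Computability.AlgebraicComplexity.DTensorGaugePoints
import Literature.Computability.AlgebraicComplexity.DegenerationSpectralMonotone
import Literature.Barriers.MatrixMultiplication.UniversalMethodBarrier
import Summits.MatrixMultiplication.MatrixMultiplication.Theorems.SoloInformedConverseDoorLimit
import Summits.MatrixMultiplication.MatrixMultiplication.Theorems.OutsiderSandwichPolystableRigidity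
import Summits.MatrixMultiplication.MatrixMultiplication.Theorems.OutsiderSandwichCwTwoPowPolystable
import Summits.MatrixMultiplication.MatrixMultiplication.Theorems.OutsiderSandwichUnitKroneckerRigidity
import Summits.MatrixMultiplication.MatrixMultiplication.Theorems.OutsiderSandwichMinrankGap
import Summits.MatrixMultiplication.MatrixMultiplication.Theorems.OutsiderSandwichRestrictionGap
import Summits.MatrixMultiplication.MatrixMultiplication.Theorems.OutsiderSandwichDegenerationBridge
import Summits.MatrixMultiplication.MatrixMultiplication.Theorems.OutsiderSandwichMinrankExact
import Summits.MatrixMultiplication.MatrixMultiplication.Theorems.OutsiderSandwichTwoSidedGap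

/-!
# OutsiderSandwich — slice-rank parity, part 1: every slice of `⟨n'⟩ ⊠ ⟨m,m,m⟩` has rank divisible by
`m`; `⟨n⟩ ⊠ cw₂^{⊠N}` has a slice of rank exactly `3^N` (lens-4 g33, K33-F part 1; the consequences —
degeneration-incomparability at every finite level `N ≥ 1` — are in `OutsiderSandwichFiniteShadow`)

Route-independent support kernel (no `Theses` import, no new definitions).

A second `GL³`-invariant of the slice pencil finishes what `minrank` (`OutsiderSandwichTwoSidedGap`: a
degeneration in either direction forces `m = 2^N`) left open on the slope-one line `m = 2^N`:

* every coordinate slice of `⟨n'⟩ ⊠ ⟨m,m,m⟩` is, up to relabelling rows and columns, a Kronecker product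
  `Y ⊗ₖ 1_m`, so ITS RANK IS DIVISIBLE BY `m` (`dvd_rank_contract3_unitKronecker_matMul`, via the tree's
  `DTensor.rank_kroneckerMap_mul`);
* `⟨n⟩ ⊠ cw₂^{⊠N}` has a slice of rank exactly `3^N` (`rank_contract3_unitKronecker_cwTwoPow_blockOnes`: the
  covector `e_{u₀} ⊗ (1,1,1)^{⊗N}`; the all-ones slice `S = [[0,1,1],[1,1,0],[1,0,1]]` of `cw₂` is invertible and
  the slice is `E_{u₀u₀} ⊗ₖ S^{⊗ₖ N}`).

Slice ranks are preserved by `w ↦ c • (s₁ ⊗ s₂ ⊗ s₃)·w` (`rank_contract3_smul_actTensor`), so the Kempf–Ness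
isomorphism behind any degeneration between the two (polystable) tensors forces `m ∣ 3^N`
(`OutsiderSandwichFiniteShadow.dvd_three_pow_of_degeneratesTo`); with `m = 2^N` this is impossible for `N ≥ 1`.

Honest tag: `ω`-free negative calibration (support lemmas; no asymptotic content).

References: [cite: KempfNess1979, Thm. 0.2]; [cite: BlaserIkenmeyerLysikovPandeySchreyer2019, Def. 13, Lemma 18];
[cite: ChristandlVranaZuiddam2023, Example 1.4]; [cite: CoppersmithWinograd1990, §6];
[cite: BurgisserClausenShokrollahi1997, (14.22), (15.19)]; [cite: Alman2021, §2.4].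
-/

noncomputable section

open scoped BigOperators Matrix

open Literature.Computability.AlgebraicComplexity
open Literature.Barriers.MatrixMultiplication

namespace Summit.MatrixMultiplication.MatrixMultiplication.Theorems.OutsiderSandwichSliceParity

open OutsiderSandwichPolystableRigidity OutsiderSandwichCwTwoPowPolystable
  OutsiderSandwichUnitKroneckerRigidity OutsiderSandwichMinrankGap OutsiderSandwichRestrictionGap
  OutsiderSandwichDegenerationBridge OutsiderSandwichMinrankExact OutsiderSandwichTwoSidedGap

/-! ## §0  Slices of a Kronecker product at a product covector -/

/-- The slice of `s ⊠ t` at a product covector `x₁ ⊗ x₂` is the Kronecker product of the slices.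
[cite: ChristandlVranaZuiddam2023, Example 1.4] -/
theorem contract3_kroneckerTensor_mul {ι κ μ ι' κ' μ' : Type*} [Fintype ι] [Fintype ι']
    (s : ι → κ → μ → ℂ) (t : ι' → κ' → μ' → ℂ) (x₁ : ι → ℂ) (x₂ : ι' → ℂ) :
    contract3 (kroneckerTensor s t) (fun a => x₁ a.1 * x₂ a.2) =
      Matrix.kroneckerMap (· * ·) (contract3 s x₁) (contract3 t x₂) := by
  ext b c
  simp only [contract3, kroneckerTensor_apply, Matrix.kroneckerMap_apply, Fintype.sum_prod_type,
    Finset.sum_mul_sum]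
  refine Finset.sum_congr rfl fun a _ => Finset.sum_congr rfl fun a' _ => ?_
  ring

/-! ## §1  Matrix-multiplication side: every slice rank is divisible by `m` -/

section MatMulSide

/-- The coordinate slice of `⟨n'⟩ ⊠ ⟨m,m,m⟩` at `x` is `Y_x ⊗ₖ 1_m` up to relabelling rows and columns,
where `Y_x = ⊕_v X_v`, `X_v = (x_{(v,(i,j))})_{i,j}`. [cite: BurgisserClausenShokrollahi1997, (14.22)] -/
theorem contract3_unitKronecker_matMul_eq {n' m : ℕ} (x : Fin n' × (Fin m × Fin m) → ℂ) :
    contract3 (kroneckerTensor (unitTensor ℂ n') (matMulTensor ℂ m m m)) x =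
      (Matrix.kroneckerMap (· * ·)
          (Matrix.of fun r c : Fin n' × Fin m => if r.1 = c.1 then x (r.1, (r.2, c.2)) else 0)
          (1 : Matrix (Fin m) (Fin m) ℂ)).submatrix
        ⇑(Equiv.prodAssoc (Fin n') (Fin m) (Fin m)).symm
        ⇑((Equiv.prodCongr (Equiv.refl (Fin n')) (Equiv.prodComm (Fin m) (Fin m))).trans
          (Equiv.prodAssoc (Fin n') (Fin m) (Fin m)).symm) := by
  classical
  ext ⟨v, i₂, μ⟩ ⟨w, μ₂, j₂⟩
  simp only [contract3, Matrix.submatrix_apply, Matrix.kroneckerMap_apply, Matrix.of_apply,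
    Matrix.one_apply, Equiv.prodAssoc_symm_apply, Equiv.trans_apply, Equiv.prodCongr_apply,
    Equiv.coe_refl, Prod.map_apply, id_eq, Equiv.prodComm_apply, Prod.swap_prod_mk]
  rw [Finset.sum_eq_single (v, (i₂, j₂)) ?_ (by simp)]
  · by_cases hvw : v = w
    · by_cases hμ : μ = μ₂
      · simp [matMulTensor, hvw, hμ]
      · simp [matMulTensor, hvw, hμ]
    · simp [matMulTensor, hvw]
  · rintro ⟨u, i, j⟩ _ hne
    by_cases hu : u = v
    · by_cases hi : i = i₂
      · have hj : j ≠ j₂ := fun hj => hne (by rw [hu, hi, hj])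
        simp [matMulTensor, hj]
      · simp [matMulTensor, hi]
    · simp [hu]

/-- **The rank of every slice of `⟨n'⟩ ⊠ ⟨m,m,m⟩` is `m · rank(Y_x)`.** [cite: ChristandlVranaZuiddam2023, Example 1.4] -/
theorem rank_contract3_unitKronecker_matMul_eq {n' m : ℕ} (x : Fin n' × (Fin m × Fin m) → ℂ) :
    (contract3 (kroneckerTensor (unitTensor ℂ n') (matMulTensor ℂ m m m)) x).rank =
      (Matrix.of fun r c : Fin n' × Fin m => if r.1 = c.1 then x (r.1, (r.2, c.2)) else 0).rank * m := by
  rw [contract3_unitKronecker_matMul_eq, Matrix.rank_submatrix, DTensor.rank_kroneckerMap_mul,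
    Matrix.rank_one, Fintype.card_fin]

/-- **`m` divides the rank of every slice of `⟨n'⟩ ⊠ ⟨m,m,m⟩`.** [cite: BurgisserClausenShokrollahi1997, (14.22)] -/
theorem dvd_rank_contract3_unitKronecker_matMul {n' m : ℕ} (x : Fin n' × (Fin m × Fin m) → ℂ) :
    m ∣ (contract3 (kroneckerTensor (unitTensor ℂ n') (matMulTensor ℂ m m m)) x).rank :=
  ⟨_, by rw [rank_contract3_unitKronecker_matMul_eq, mul_comm]⟩

/-- … and of every slice of any relabelling `e^*(⟨n'⟩ ⊠ ⟨m,m,m⟩)`. [cite: BurgisserClausenShokrollahi1997, (14.22)] -/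
theorem dvd_rank_contract3_relabel_unitKronecker_matMul {ι' : Type} [Fintype ι'] [DecidableEq ι']
    {n' m : ℕ} (e : ι' ≃ (Fin n' × (Fin m × Fin m))) (y : ι' → ℂ) :
    m ∣ (contract3 (fun a b c => kroneckerTensor (unitTensor ℂ n') (matMulTensor ℂ m m m)
      (e a) (e b) (e c)) y).rank := by
  classical
  set x : Fin n' × (Fin m × Fin m) → ℂ := fun a => y (e.symm a) with hx
  have hyx : y = fun a => x (e a) := by
    funext a
    simp [hx]
  rw [hyx, contract3_relabel, Matrix.rank_submatrix]
  exact dvd_rank_contract3_unitKronecker_matMul x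

end MatMulSide

/-! ## §2  Coppersmith–Winograd side: a slice of rank exactly `3^N` -/

section CwSide

/-- The all-ones slice `S = Σᵢ cw₂(i,·,·) = [[0,1,1],[1,1,0],[1,0,1]]` of `cw₂` is invertible:
`S · S⁻¹ = 1` with `S⁻¹ = ½[[-1,1,1],[1,1,-1],[1,-1,1]]`. [cite: CoppersmithWinograd1990, §6] -/
theorem cwTwo_onesSlice_mul_inv :
    (Matrix.of fun j k : Fin 3 => ∑ i : Fin 3, cwTensor ℂ 2 i j k) *
      (!![-1/2, 1/2, 1/2; 1/2, 1/2, -1/2; 1/2, -1/2, 1/2] : Matrix (Fin 3) (Fin 3) ℂ) = 1 := by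
  ext j k
  simp only [Matrix.mul_apply, Matrix.of_apply, Fin.sum_univ_three]
  fin_cases j <;> fin_cases k <;> simp [cwTensor] <;> norm_num

/-- The all-ones slice of `cw₂^{⊠N}` is the `N`-fold Kronecker power of `S`. [cite: CoppersmithWinograd1990, §6] -/
theorem contract3_cwTwoPow_ones (N : ℕ) :
    contract3 (kroneckerPow (cwTensor ℂ 2) N) (fun _ => (1 : ℂ)) =
      Matrix.of fun β γ : Fin N → Fin 3 => ∏ p, ∑ i : Fin 3, cwTensor ℂ 2 i (β p) (γ p) := by
  ext β γ
  simp only [contract3, one_mul, kroneckerPow_apply, Matrix.of_apply]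
  exact (Fintype.prod_sum fun p i => cwTensor ℂ 2 i (β p) (γ p)).symm

/-- `S^{⊗ₖ N} · (S⁻¹)^{⊗ₖ N} = 1`. [cite: CoppersmithWinograd1990, §6] -/
theorem cwTwoPow_onesSlice_mul_inv (N : ℕ) :
    (Matrix.of fun β γ : Fin N → Fin 3 => ∏ p, ∑ i : Fin 3, cwTensor ℂ 2 i (β p) (γ p)) *
      (Matrix.of fun γ δ : Fin N → Fin 3 => ∏ p,
        (!![-1/2, 1/2, 1/2; 1/2, 1/2, -1/2; 1/2, -1/2, 1/2] : Matrix (Fin 3) (Fin 3) ℂ) (γ p) (δ p)) =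
      1 := by
  set Sinv : Matrix (Fin 3) (Fin 3) ℂ :=
    (!![-1/2, 1/2, 1/2; 1/2, 1/2, -1/2; 1/2, -1/2, 1/2] : Matrix (Fin 3) (Fin 3) ℂ) with hSinv
  ext β δ
  have h1 : ∀ p : Fin N, (∑ j : Fin 3, (∑ i : Fin 3, cwTensor ℂ 2 i (β p) j) * Sinv j (δ p)) =
      if β p = δ p then 1 else 0 := by
    intro p
    have := congr_fun (congr_fun cwTwo_onesSlice_mul_inv (β p)) (δ p)
    rw [← hSinv, Matrix.mul_apply, Matrix.one_apply] at this
    simpa only [Matrix.of_apply] using this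
  rw [Matrix.mul_apply, Matrix.one_apply]
  simp only [Matrix.of_apply, ← Finset.prod_mul_distrib]
  rw [← Fintype.prod_sum fun p j => (∑ i : Fin 3, cwTensor ℂ 2 i (β p) j) * Sinv j (δ p)]
  simp_rw [h1]
  rw [Fintype.prod_boole]
  by_cases h : β = δ
  · subst h
    simp
  · rw [if_neg h, if_neg fun h' => h (funext h')]

/-- **The all-ones slice of `cw₂^{⊠N}` has rank `3^N`.** [cite: CoppersmithWinograd1990, §6] -/
theorem rank_contract3_cwTwoPow_ones (N : ℕ) :
    (contract3 (kroneckerPow (cwTensor ℂ 2) N) (fun _ => (1 : ℂ))).rank = 3 ^ N := by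
  rw [contract3_cwTwoPow_ones, Matrix.rank_of_isUnit _ ((Matrix.isUnit_iff_isUnit_det _).2
    (Matrix.isUnit_det_of_right_inverse (cwTwoPow_onesSlice_mul_inv N))), Fintype.card_fun,
    Fintype.card_fin, Fintype.card_fin]

/-- The slice of `⟨n⟩` at `e_{u₀}` is the rank-one diagonal matrix `E_{u₀u₀}`. [folklore] -/
theorem contract3_unitTensor_single {n : ℕ} (u₀ : Fin n) :
    contract3 (unitTensor ℂ n) (fun a => if a = u₀ then (1 : ℂ) else 0) =
      Matrix.diagonal (fun b => if b = u₀ then (1 : ℂ) else 0) := by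
  ext b c
  simp only [contract3, unitTensor_apply, Matrix.diagonal_apply]
  rw [Finset.sum_eq_single u₀ (fun a _ ha => by simp [ha]) (by simp)]
  by_cases hbc : b = c
  · subst hbc
    by_cases hb : b = u₀
    · subst hb
      simp
    · simp [hb, Ne.symm hb]
  · simp [hbc]

/-- `rank E_{u₀u₀} = 1`. [folklore] -/
theorem rank_contract3_unitTensor_single {n : ℕ} (u₀ : Fin n) :
    (contract3 (unitTensor ℂ n) (fun a => if a = u₀ then (1 : ℂ) else 0)).rank = 1 := by
  classical
  rw [contract3_unitTensor_single, Matrix.rank_diagonal]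
  have : Fintype.card {b : Fin n // (if b = u₀ then (1 : ℂ) else 0) ≠ 0} =
      Fintype.card {b : Fin n // b = u₀} :=
    Fintype.card_congr (Equiv.subtypeEquivRight fun b => by simp)
  rw [this, Fintype.card_subtype_eq]

/-- **`⟨n⟩ ⊠ cw₂^{⊠N}` has a slice of rank exactly `3^N`**: the covector `e_{u₀} ⊗ (1,…,1)` gives
`E_{u₀u₀} ⊗ₖ S^{⊗ₖN}`. [cite: ChristandlVranaZuiddam2023, Example 1.4] [cite: CoppersmithWinograd1990, §6] -/
theorem rank_contract3_unitKronecker_cwTwoPow_blockOnes {n N : ℕ} (u₀ : Fin n) :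
    (contract3 (kroneckerTensor (unitTensor ℂ n) (kroneckerPow (cwTensor ℂ 2) N))
      (fun a => if a.1 = u₀ then (1 : ℂ) else 0)).rank = 3 ^ N := by
  have h := congr_arg Matrix.rank (contract3_kroneckerTensor_mul (unitTensor ℂ n)
    (kroneckerPow (cwTensor ℂ 2) N) (fun a₁ : Fin n => if a₁ = u₀ then (1 : ℂ) else 0)
    (fun _ : Fin N → Fin 3 => (1 : ℂ)))
  rw [DTensor.rank_kroneckerMap_mul, rank_contract3_unitTensor_single, rank_contract3_cwTwoPow_ones,
    one_mul] at h
  convert h using 3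
  funext a
  simp

end CwSide

/-! ## §3  Slice ranks are preserved by `w ↦ c • (s₁ ⊗ s₂ ⊗ s₃)·w` -/

/-- `rank (slice of c • (s₁ ⊗ s₂ ⊗ s₃)·w at y) = rank (slice of w at y s₁)`.
[cite: BlaserIkenmeyerLysikovPandeySchreyer2019, Lemma 18] -/
theorem rank_contract3_smul_actTensor {ι : Type} [Fintype ι] [DecidableEq ι] {c : ℂ} (hc : c ≠ 0)
    (s : Matrix.SpecialLinearGroup ι ℂ × Matrix.SpecialLinearGroup ι ℂ × Matrix.SpecialLinearGroup ι ℂ)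
    (w : ι → ι → ι → ℂ) (y : ι → ℂ) :
    (contract3 (c • actTensor (s.1 : Matrix ι ι ℂ) (s.2.1 : Matrix ι ι ℂ) (s.2.2 : Matrix ι ι ℂ) w)
        y).rank = (contract3 w (Matrix.vecMul y (s.1 : Matrix ι ι ℂ))).rank := by
  have h2 : IsUnit (c • (s.2.1 : Matrix ι ι ℂ)).det := by
    rw [Matrix.det_smul, Matrix.SpecialLinearGroup.det_coe, mul_one]
    exact isUnit_iff_ne_zero.mpr (pow_ne_zero _ hc)
  have h3 : IsUnit ((s.2.2 : Matrix ι ι ℂ)ᵀ).det := by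
    rw [Matrix.det_transpose, Matrix.SpecialLinearGroup.det_coe]; exact isUnit_one
  rw [contract3_smul, contract3_actTensor, ← Matrix.smul_mul, ← Matrix.smul_mul,
    Matrix.rank_mul_eq_left_of_isUnit_det _ _ h3, Matrix.rank_mul_eq_right_of_isUnit_det _ _ h2]

/-- The covector `x s₁⁻¹` pulls back to `x`: `(x s₁⁻¹) s₁ = x`. [folklore] -/
theorem vecMul_inv_vecMul {ι : Type} [Fintype ι] [DecidableEq ι]
    (A : Matrix.SpecialLinearGroup ι ℂ) (x : ι → ℂ) :
    Matrix.vecMul (Matrix.vecMul x (A : Matrix ι ι ℂ)⁻¹) (A : Matrix ι ι ℂ) = x := by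
  have hdet : IsUnit (A : Matrix ι ι ℂ).det := by
    rw [Matrix.SpecialLinearGroup.det_coe]; exact isUnit_one
  rw [Matrix.vecMul_vecMul, Matrix.nonsing_inv_mul _ hdet, Matrix.vecMul_one]

end Summit.MatrixMultiplication.MatrixMultiplication.Theorems.OutsiderSandwichSliceParity

end
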